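import Literature.Computability.Complexity.NumProgramsRemTree
import HarnessLib

/-!
# Numeric register programs, VIII: the Pollard–Strassen scan of an arithmetic progression

Literature / complexity toolkit, continuing `NumProgramsRemTree.lean`.  Harvey 2021,
Proposition 2.5 (after Strassen, Pollard, Bostan–Gaudry–Schost): the least prime divisor
`p ≤ B` of `N` is found in time `B^{1/2} · lg^{O(1)} N` by evaluating
`g(X) = ∏_{1 ≤ j ≤ d} (X + j)` at the `d` points `0, d, 2d, …` (`d ≈ B^{1/2}`) with the product
and remainder trees and taking gcds with `N`: the first block whose product is not coprime to
`N` contains `p`, a linear scan of that block finds it.  We formalise the scan of a general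
arithmetic progression `s + M k`, `1 ≤ k ≤ d²` (`s = 0, M = 1` is Proposition 2.5; `s = 1`
and `M` a known divisor of `p - 1` is the final step of the deterministic search for a large
prime factor in the simplified Proposition 2.7):

* the mathematics (`apRoots`, `apPoints`, **`nodePoly_apRoots`**, **`eval_apPoly`**,
  **`one_lt_gcd_prod_iff`**, **`apBlock_criterion`**, **`minFac_eq_of_least`**);
* the program `apScanP` and its specification (next part of the file).

## References

* D. Harvey, *An exponent one-fifth algorithm for deterministic integer factorisation*, Math.
  Comp. 90 (2021), §2.3, Proposition 2.5 [Harvey2021].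
* V. Strassen, *Einige Resultate über Berechnungskomplexität*, Jber. Deutsch. Math.-Verein.
  78 (1976/77), 1–8 (the `d`-block product method) [Strassen1976].
* J. von zur Gathen, J. Gerhard, *Modern Computer Algebra*, 3rd ed., CUP 2013, §19.3
  (Pollard's and Strassen's method) [GathenGerhard2013].
-/

namespace Literature.Computability.Complexity

open _root_.Computability Polynomial

/-! ### The arithmetic progression, its polynomial and its blocks -/

section APData

variable (N s M d : ℕ)

/-- The roots `-(s + M j) mod N`, `1 ≤ j ≤ d`, of `g(X) = ∏_j (X + s + M j)`. [folklore] -/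
def apRoots : List ℕ := (List.range d).map fun j => (N - (s + M * (j + 1)) % N) % N

/-- The first `c` evaluation points `M d u mod N`, `u < c` (all of them: `c = d`). [folklore] -/
def apPoints (c : ℕ) : List ℕ := (List.range c).map fun u => (M * d * u) % N

/-- The candidate `s + M k`. [folklore] -/
def apCand (k : ℕ) : ℕ := s + M * k

/-- The product of the candidates of block `u`: `∏_{1 ≤ j ≤ d} (s + M (u d + j))`. [folklore] -/
def apBlockProd (u : ℕ) : ℕ := ((List.range d).map fun j => apCand s M (u * d + (j + 1))).prod

variable {N s M d}

/-- Number of roots. [folklore] -/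
@[simp] theorem length_apRoots : (apRoots N s M d).length = d := by simp [apRoots]
/-- Number of points. [folklore] -/
@[simp] theorem length_apPoints (c : ℕ) : (apPoints N M d c).length = c := by simp [apPoints]

/-- Roots are reduced (`0 < N`). [folklore] -/
theorem lt_of_mem_apRoots (hN : 0 < N) {x : ℕ} (hx : x ∈ apRoots N s M d) : x < N := by
  simp only [apRoots, List.mem_map, List.mem_range] at hx
  obtain ⟨j, -, rfl⟩ := hx; exact Nat.mod_lt _ hN

/-- Points are reduced (`0 < N`). [folklore] -/
theorem lt_of_mem_apPoints (hN : 0 < N) {c x : ℕ} (hx : x ∈ apPoints N M d c) : x < N := by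
  simp only [apPoints, List.mem_map, List.mem_range] at hx
  obtain ⟨u, -, rfl⟩ := hx; exact Nat.mod_lt _ hN

/-- The root list codes `∏_j (X + (s + M j))`. [folklore] -/
theorem nodePoly_apRoots (hN : 0 < N) :
    nodePoly N (apRoots N s M d) = ((List.range d).map fun j => X + C ((s + M * (j + 1) : ℕ) : ZMod N)).prod := by
  unfold apRoots
  induction d with
  | zero => simp
  | succ d ih =>
    simp only [List.range_succ, List.map_append, List.map_singleton, nodePoly_append, List.prod_append, List.prod_singleton, nodePoly_cons,
      nodePoly_nil, mul_one]
    rw [ih]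
    congr 1
    have hcast : ((((N - (s + M * (d + 1)) % N) % N : ℕ) : ZMod N)) = -((s + M * (d + 1) : ℕ) : ZMod N) := by
      rw [ZMod.natCast_mod, Nat.cast_sub (Nat.mod_lt _ hN).le, ZMod.natCast_self, zero_sub, ZMod.natCast_mod]
    rw [hcast, map_neg, sub_neg_eq_add]

/-- The value of the block polynomial at the point of block `u` is the block product.
[folklore] -/
theorem eval_apPoly (hN : 0 < N) (u : ℕ) :
    (nodePoly N (apRoots N s M d)).eval (((M * d * u) % N : ℕ) : ZMod N) = ((apBlockProd s M d u : ℕ) : ZMod N) := by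
  rw [nodePoly_apRoots hN, Polynomial.eval_list_prod, apBlockProd, List.map_map, Nat.cast_list_prod, List.map_map]
  congr 1
  refine List.map_congr_left fun j _ => ?_
  simp only [Function.comp_apply, Polynomial.eval_add, Polynomial.eval_X, Polynomial.eval_C, apCand, ZMod.natCast_mod]
  push_cast
  ring

/-- `1 < gcd (x mod N) N ↔ 1 < gcd x N`. [folklore] -/
theorem one_lt_gcd_mod_iff (x : ℕ) : 1 < Nat.gcd (x % N) N ↔ 1 < Nat.gcd x N := by
  rw [show Nat.gcd (x % N) N = Nat.gcd x N from (Nat.gcd_rec N x).symm.trans (Nat.gcd_comm N x)]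

/-- A product is not coprime to `N` iff some factor is not (`1 ≤ N`). [folklore] -/
theorem one_lt_gcd_prod_iff (hN : 1 ≤ N) (l : List ℕ) : 1 < Nat.gcd l.prod N ↔ ∃ x ∈ l, 1 < Nat.gcd x N := by
  have key : ∀ y : ℕ, 1 < Nat.gcd y N ↔ ¬ Nat.Coprime y N := by
    intro y
    rw [Nat.Coprime]
    have : 0 < Nat.gcd y N := Nat.gcd_pos_of_pos_right _ (by omega)
    omega
  induction l with
  | nil => simp
  | cons a l ih =>
    rw [List.prod_cons, key, Nat.coprime_mul_iff_left, not_and_or, ← key, ← key]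
    constructor
    · rintro (h | h)
      · exact ⟨a, List.mem_cons_self, h⟩
      · obtain ⟨x, hx, h⟩ := ih.1 h; exact ⟨x, List.mem_cons_of_mem _ hx, h⟩
    · rintro ⟨x, hx, h⟩
      rcases List.mem_cons.1 hx with rfl | hx
      · exact Or.inl h
      · exact Or.inr (ih.2 ⟨x, hx, h⟩)

/-- **The block criterion**: the value computed for block `u` is not coprime to `N` iff some
candidate `s + M (u d + j)`, `1 ≤ j ≤ d`, is not. [Harvey 2021, proof of Prop. 2.5] [folklore] -/
theorem apBlock_criterion (hN : 1 ≤ N) (u : ℕ) :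
    1 < Nat.gcd (apBlockProd s M d u % N) N ↔ ∃ j, j < d ∧ 1 < Nat.gcd (apCand s M (u * d + (j + 1))) N := by
  rw [one_lt_gcd_mod_iff, apBlockProd, one_lt_gcd_prod_iff hN]
  simp only [List.mem_map, List.mem_range]
  constructor
  · rintro ⟨x, ⟨j, hj, rfl⟩, hx⟩; exact ⟨j, hj, hx⟩
  · rintro ⟨j, hj, hx⟩; exact ⟨_, ⟨j, hj, rfl⟩, hx⟩

/-- For `s = 0`, `M = 1`: the least `k ≥ 1` not coprime to `N ≥ 2` is the least prime
factor of `N`. [folklore] -/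
theorem minFac_eq_of_least {k : ℕ} (hN : 2 ≤ N) (hk1 : 1 ≤ k) (hk : 1 < Nat.gcd k N)
    (hleast : ∀ k', 1 ≤ k' → k' < k → Nat.gcd k' N ≤ 1) : k = Nat.minFac N := by
  have hk2 : 2 ≤ k := by
    by_contra h; have : k = 1 := by omega
    subst this; simp at hk
  -- `minFac N ≤ k`: a prime factor of `gcd k N` divides both
  have hle : Nat.minFac N ≤ k := by
    obtain ⟨q, hq, hqd⟩ := Nat.exists_prime_and_dvd (show Nat.gcd k N ≠ 1 by omega)
    have hqk : q ∣ k := hqd.trans (Nat.gcd_dvd_left _ _)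
    have hqN : q ∣ N := hqd.trans (Nat.gcd_dvd_right _ _)
    exact (Nat.minFac_le_of_dvd hq.two_le hqN).trans (Nat.le_of_dvd (by omega) hqk)
  -- `k ≤ minFac N`: the least prime factor is itself a candidate
  have hge : k ≤ Nat.minFac N := by
    by_contra h
    have h1 := hleast (Nat.minFac N) (Nat.minFac_pos N) (by omega)
    have : Nat.gcd (Nat.minFac N) N = Nat.minFac N := Nat.gcd_eq_left (Nat.minFac_dvd N)
    rw [this] at h1
    have := (Nat.minFac_prime (by omega : N ≠ 1)).two_le
    omega
  omega

end APData

namespace NCom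

variable {S V O X E : Type} [DecidableEq S] [DecidableEq V] [DecidableEq O] {𝓔 : NExt S V O X E}

/-! ### The scan program -/

/-- Scalar roles of `apScanP`: those of the product tree, of the remainder tree, of the gcd,
the inputs `n, s, M, K`, and the scan's own counters and outputs. [folklore] -/
inductive ApS where
  | pt (i : PTreeS) | rm (i : RemS) | gc (i : GcdR)
  | n | s | M | K | d | u | j | cnt | tmp | tmp2 | q | flag | ublk | found | kout | one | L
  deriving DecidableEq

/-- Queue roles of `apScanP`: those of the product tree and of the remainder tree. [folklore] -/
inductive ApV where
  | pv (i : PTreeV) | rv (i : RemV)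
  deriving DecidableEq

/-- Accumulator roles of `apScanP`. [folklore] -/
inductive ApO where
  | po (i : PTreeO) | ro (i : RemO)
  deriving DecidableEq

/-- Embeddings of the sub-routines' role banks. [folklore] -/
def ApS.ptE : PTreeS ↪ ApS := ⟨ApS.pt, fun _ _ h => ApS.pt.inj h⟩
/-- Embeddings of the sub-routines' role banks. [folklore] -/
def ApS.rmE : RemS ↪ ApS := ⟨ApS.rm, fun _ _ h => ApS.rm.inj h⟩
/-- Embeddings of the sub-routines' role banks. [folklore] -/
def ApS.gcE : GcdR ↪ ApS := ⟨ApS.gc, fun _ _ h => ApS.gc.inj h⟩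
/-- Embeddings of the sub-routines' role banks. [folklore] -/
def ApV.pvE : PTreeV ↪ ApV := ⟨ApV.pv, fun _ _ h => ApV.pv.inj h⟩
/-- Embeddings of the sub-routines' role banks. [folklore] -/
def ApV.rvE : RemV ↪ ApV := ⟨ApV.rv, fun _ _ h => ApV.rv.inj h⟩
/-- Embeddings of the sub-routines' role banks. [folklore] -/
def ApO.poE : PTreeO ↪ ApO := ⟨ApO.po, fun _ _ h => ApO.po.inj h⟩
/-- Embeddings of the sub-routines' role banks. [folklore] -/
def ApO.roE : RemO ↪ ApO := ⟨ApO.ro, fun _ _ h => ApO.ro.inj h⟩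

/-- Unfolding the embedding. [folklore] -/ @[simp] theorem ApS.ptE_apply (i : PTreeS) : ApS.ptE i = .pt i := rfl
/-- Unfolding the embedding. [folklore] -/ @[simp] theorem ApS.rmE_apply (i : RemS) : ApS.rmE i = .rm i := rfl
/-- Unfolding the embedding. [folklore] -/ @[simp] theorem ApS.gcE_apply (i : GcdR) : ApS.gcE i = .gc i := rfl
/-- Unfolding the embedding. [folklore] -/ @[simp] theorem ApV.pvE_apply (i : PTreeV) : ApV.pvE i = .pv i := rfl
/-- Unfolding the embedding. [folklore] -/ @[simp] theorem ApV.rvE_apply (i : RemV) : ApV.rvE i = .rv i := rfl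
/-- Unfolding the embedding. [folklore] -/ @[simp] theorem ApO.poE_apply (i : PTreeO) : ApO.poE i = .po i := rfl
/-- Unfolding the embedding. [folklore] -/ @[simp] theorem ApO.roE_apply (i : RemO) : ApO.roE i = .ro i := rfl

section Ap

variable (M : Multiplier 𝓔) (ρ : ApS ↪ S) (ν : ApV ↪ V) (ω : ApO ↪ O)

local notation "ρt" => (ApS.ptE.trans ρ)
local notation "νt" => (ApV.pvE.trans ν)
local notation "ωt" => (ApO.poE.trans ω)
local notation "ρr" => (ApS.rmE.trans ρ)
local notation "νr" => (ApV.rvE.trans ν)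
local notation "ωr" => (ApO.roE.trans ω)
local notation "ρg" => (ApS.gcE.trans ρ)
/-- the transfer scalar -/ local notation "𝔵" => ρ (ApS.pt (PTreeS.pm PMulS.x))
/-- the transfer accumulator -/ local notation "𝔞" => ω (ApO.po PTreeO.acc)

/-- Initialisation: constants, the moduli of both banks, `d := 2^K`. [folklore] -/
def apInit : NCom S V O E :=
  setc (ρ .one) 1 ;ₙ mov (ρ (.pt (.pm .n))) (ρ .n) ;ₙ mov (ρ (.rm (.dv (.iv (.pm .n))))) (ρ .n) ;ₙ
  setc (ρ .d) 1 ;ₙ times (ρ .K) (add (ρ .d) (ρ .d) (ρ .d))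

/-- The roots `-(s + M j) mod N`, `j = 1 … d`, into the product tree's value queue. [folklore] -/
def apRootsBody : NCom S V O E :=
  add (ρ .j) (ρ .j) (ρ .one) ;ₙ mul (ρ .tmp) (ρ .M) (ρ .j) ;ₙ add (ρ .tmp) (ρ .tmp) (ρ .s) ;ₙ
  divmod (ρ .q) (ρ .tmp2) (ρ .tmp) (ρ .n) ;ₙ sub (ρ .tmp) (ρ .n) (ρ .tmp2) ;ₙ divmod (ρ .q) (ρ .tmp2) (ρ .tmp) (ρ .n) ;ₙ
  emit 𝔞 (ρ .tmp2)

/-- The points `M d u mod N`, `u < d`, into the product tree's value queue. [folklore] -/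
def apPointsBody : NCom S V O E :=
  mul (ρ .tmp) (ρ .M) (ρ .d) ;ₙ mul (ρ .tmp) (ρ .tmp) (ρ .u) ;ₙ divmod (ρ .q) (ρ .tmp2) (ρ .tmp) (ρ .n) ;ₙ emit 𝔞 (ρ .tmp2) ;ₙ
  add (ρ .u) (ρ .u) (ρ .one)

/-- Stage 1: the tree of `g`, its coefficient list to `GIN`. [folklore] -/
def apStage1 : NCom S V O E :=
  setc (ρ .j) 0 ;ₙ times (ρ .d) (apRootsBody ρ ω) ;ₙ pour 𝔞 (ν (.pv .vals)) ;ₙ mov (ρ (.pt .nv)) (ρ .d) ;ₙ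
  (ptreeP M ρt νt ωt ;ₙ
  (add (ρ .cnt) (ρ .d) (ρ .one) ;ₙ moveN (ν (.pv .tree)) 𝔞 𝔵 (ρ .cnt) ;ₙ pour 𝔞 (ν (.rv .GIN)) ;ₙ clearV (ν (.pv .tree))))

/-- Stage 2: the tree of the points, moved to the remainder tree's queue. [folklore] -/
def apStage2 : NCom S V O E :=
  setc (ρ .u) 0 ;ₙ times (ρ .d) (apPointsBody ρ ω) ;ₙ pour 𝔞 (ν (.pv .vals)) ;ₙ mov (ρ (.pt .nv)) (ρ .d) ;ₙ
  (ptreeP M ρt νt ωt ;ₙ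
  (setc (ρ .tmp) 3 ;ₙ add (ρ .L) (ρ .K) (ρ .tmp) ;ₙ mul (ρ .L) (ρ .L) (ρ .d) ;ₙ sub (ρ .L) (ρ .L) (ρ .one) ;ₙ
   moveN (ν (.pv .tree)) 𝔞 𝔵 (ρ .L) ;ₙ pour 𝔞 (ν (.rv .TREE)) ;ₙ
   mov (ρ (.rm .K)) (ρ .K) ;ₙ mov (ρ (.rm .P)) (ρ .d) ;ₙ setc (ρ (.rm .top)) 1))

/-- The block scan: pop a value, gcd with `N`, record the first block that is not coprime.
[folklore] -/
def apBlockBody : NCom S V O E :=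
  pop (ν (.rv .REM)) (ρ (.gc .a)) ;ₙ mov (ρ (.gc .b)) (ρ .n) ;ₙ gcdP ρg ;ₙ
  ifLt (ρ .one) (ρ (.gc .a)) (ifPos (ρ .flag) skip (mov (ρ .ublk) (ρ .u) ;ₙ setc (ρ .flag) 1)) skip ;ₙ
  add (ρ .u) (ρ .u) (ρ .one)

/-- The scan inside the block found: the candidates `s + M (ublk d + j)`, `j = 1 … d`. [folklore] -/
def apCandBody : NCom S V O E :=
  add (ρ .j) (ρ .j) (ρ .one) ;ₙ mul (ρ .tmp) (ρ .ublk) (ρ .d) ;ₙ add (ρ .tmp) (ρ .tmp) (ρ .j) ;ₙ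
  mul (ρ (.gc .a)) (ρ .M) (ρ .tmp) ;ₙ add (ρ (.gc .a)) (ρ (.gc .a)) (ρ .s) ;ₙ mov (ρ (.gc .b)) (ρ .n) ;ₙ gcdP ρg ;ₙ
  ifLt (ρ .one) (ρ (.gc .a)) (ifPos (ρ .found) skip (mov (ρ .kout) (ρ .tmp) ;ₙ setc (ρ .found) 1)) skip

/-- Stage 3: the two scans. [folklore] -/
def apStage3 : NCom S V O E :=
  sizeOf (ρ (.gc .t)) (ρ .n) ;ₙ add (ρ (.gc .t)) (ρ (.gc .t)) (ρ (.gc .t)) ;ₙ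
  setc (ρ .flag) 0 ;ₙ setc (ρ .u) 0 ;ₙ setc (ρ .ublk) 0 ;ₙ times (ρ .d) (apBlockBody ρ ν) ;ₙ
  setc (ρ .found) 0 ;ₙ setc (ρ .kout) 0 ;ₙ setc (ρ .j) 0 ;ₙ
  ifPos (ρ .flag) (times (ρ .d) (apCandBody ρ)) skip

/-- **The arithmetic-progression scan** `apScanP`: with `d = 2^K`, afterwards `found = 1` iff
some candidate `s + M k`, `1 ≤ k ≤ d²`, is not coprime to `N`, and then `kout` is the least such
`k` (Harvey 2021, Prop. 2.5 for `s = 0`, `M = 1`: `kout` is the least prime factor of `N` if it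
is at most `d²`). [folklore] -/
def apScanP : NCom S V O E :=
  apInit ρ ;ₙ (apStage1 M ρ ν ω ;ₙ (apStage2 M ρ ν ω ;ₙ (remtreeP M ρr νr ωr ;ₙ apStage3 ρ ν)))

/-! ### The loops of the scan -/

/-- The doubling loop of `apInit`. [folklore] -/
theorem apDbl_iterate (σ : NState S V O) : ∀ i, let τ := ((add (ρ .d) (ρ .d) (ρ .d) : NCom S V O E).eval 𝓔)^[i] σ
    τ.sc (ρ .d) = 2 ^ i * σ.sc (ρ .d) ∧ (∀ r, r ≠ ρ .d → τ.sc r = σ.sc r) ∧ τ.vi = σ.vi ∧ τ.vo = σ.vo ∧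
      τ.peak ≤ max σ.peak (2 ^ i * σ.sc (ρ .d)) ∧ τ.steps = σ.steps + i
  | 0 => by simp
  | i + 1 => by
    obtain ⟨h1, h2, h3, h4, h5, h6⟩ := apDbl_iterate σ i
    intro τ
    set υ := ((add (ρ .d) (ρ .d) (ρ .d) : NCom S V O E).eval 𝓔)^[i] σ with hυ
    have hτ : τ = (add (ρ .d) (ρ .d) (ρ .d) : NCom S V O E).eval 𝓔 υ := Function.iterate_succ_apply' _ _ _
    clear_value υ
    have e : 2 ^ (i + 1) * σ.sc (ρ .d) = 2 ^ i * σ.sc (ρ .d) + 2 ^ i * σ.sc (ρ .d) := by rw [pow_succ]; ring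
    rw [hτ]
    refine ⟨?_, fun r hr => ?_, ?_, ?_, ?_, ?_⟩
    · simp only [eval, NState.sc_bump, NState.sc_setSc, Function.update_self, h1, e]
    · simp [eval, hr, h2 r hr]
    · simp [eval, h3]
    · simp [eval, h4]
    · simp only [eval, NState.peak_bump, NState.peak_setSc, h1, e]
      clear * - h5
      omega
    · simp [eval, h6]; ring

/-- Rounds of the roots loop: `acc` gains `apRoots N s M i`, `j = i`. [folklore] -/
theorem apRoots_iterate (σ : NState S V O) (hj : σ.sc (ρ .j) = 0) (hone : σ.sc (ρ .one) = 1) :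
    ∀ i, let τ := ((apRootsBody ρ ω : NCom S V O E).eval 𝓔)^[i] σ
      τ.sc (ρ .j) = i ∧ τ.vo 𝔞 = σ.vo 𝔞 ++ apRoots (σ.sc (ρ .n)) (σ.sc (ρ .s)) (σ.sc (ρ .M)) i ∧
        (∀ r : ApS, r ≠ .j → r ≠ .tmp → r ≠ .tmp2 → r ≠ .q → τ.sc (ρ r) = σ.sc (ρ r)) ∧ (∀ r, (∀ i, r ≠ ρ i) → τ.sc r = σ.sc r) ∧
        τ.vi = σ.vi ∧ (∀ p, p ≠ 𝔞 → τ.vo p = σ.vo p) ∧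
        τ.peak ≤ max σ.peak (max i (σ.sc (ρ .M) * i + σ.sc (ρ .s))) ∧ τ.steps = σ.steps + 7 * i
  | 0 => ⟨hj, by simp [apRoots], fun _ _ _ _ _ => rfl, fun _ _ => rfl, rfl, fun _ _ => rfl, le_max_left _ _, rfl⟩
  | i + 1 => by
    obtain ⟨h1, h2, h3, h4, h5, h6, h7, h8⟩ := apRoots_iterate σ hj hone i
    intro τ
    set υ := ((apRootsBody ρ ω : NCom S V O E).eval 𝓔)^[i] σ with hυ
    have hτ : τ = (apRootsBody ρ ω : NCom S V O E).eval 𝓔 υ := Function.iterate_succ_apply' _ _ _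
    clear_value υ
    have hone' : υ.sc (ρ .one) = 1 := (h3 .one (by simp) (by simp) (by simp) (by simp)).trans hone
    have hn' := h3 .n (by simp) (by simp) (by simp) (by simp)
    have hs' := h3 .s (by simp) (by simp) (by simp) (by simp)
    have hM' := h3 .M (by simp) (by simp) (by simp) (by simp)
    have e : σ.sc (ρ .M) * (i + 1) = σ.sc (ρ .M) * i + σ.sc (ρ .M) := by ring
    rw [hτ]
    refine ⟨?_, ?_, fun r r1 r2 r3 r4 => ?_, fun r hr => ?_, ?_, fun p hp => ?_, ?_, ?_⟩
    · simp [apRootsBody, eval, h1, hone']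
    · simp only [apRootsBody, eval, NState.vo_bump, NState.vo_setVo, NState.vo_setSc, NState.sc_setSc, NState.sc_bump, Function.update_apply,
        EmbeddingLike.apply_eq_iff_eq, reduceCtorEq, ite_true, ite_false, h1, hone', hn', hs', hM', h2, List.append_assoc]
      congr 1
      rw [apRoots, apRoots, List.range_succ, List.map_append, List.map_singleton]
      congr 2
      ring_nf
    · simp [apRootsBody, eval, r1, r2, r3, r4, h3 r r1 r2 r3 r4]
    · simp [apRootsBody, eval, hr, h4 r hr]
    · simp [apRootsBody, eval, h5]
    · simp [apRootsBody, eval, hp, h6 p hp]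
    · simp only [apRootsBody, eval, NState.peak_bump, NState.peak_setVo, NState.peak_setSc, NState.sc_setSc, NState.sc_bump,
        Function.update_apply, EmbeddingLike.apply_eq_iff_eq, reduceCtorEq, ite_true, ite_false, h1, hone', hn', hs', hM', Nat.max_zero, e]
      clear * - h7
      omega
    · simp [apRootsBody, eval, h8]; ring

/-- Rounds of the points loop: `acc` gains `apPoints N M d i`, `u = u₀ + i`. [folklore] -/
theorem apPoints_iterate (σ : NState S V O) (hu : σ.sc (ρ .u) = 0) (hone : σ.sc (ρ .one) = 1) :
    ∀ i, let τ := ((apPointsBody ρ ω : NCom S V O E).eval 𝓔)^[i] σ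
      τ.sc (ρ .u) = i ∧ τ.vo 𝔞 = σ.vo 𝔞 ++ apPoints (σ.sc (ρ .n)) (σ.sc (ρ .M)) (σ.sc (ρ .d)) i ∧
        (∀ r : ApS, r ≠ .u → r ≠ .tmp → r ≠ .tmp2 → r ≠ .q → τ.sc (ρ r) = σ.sc (ρ r)) ∧ (∀ r, (∀ i, r ≠ ρ i) → τ.sc r = σ.sc r) ∧
        τ.vi = σ.vi ∧ (∀ p, p ≠ 𝔞 → τ.vo p = σ.vo p) ∧
        τ.peak ≤ max σ.peak (i + σ.sc (ρ .M) * σ.sc (ρ .d) * (i + 1)) ∧ τ.steps = σ.steps + 5 * i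
  | 0 => ⟨hu, by simp [apPoints], fun _ _ _ _ _ => rfl, fun _ _ => rfl, rfl, fun _ _ => rfl, le_max_left _ _, rfl⟩
  | i + 1 => by
    obtain ⟨h1, h2, h3, h4, h5, h6, h7, h8⟩ := apPoints_iterate σ hu hone i
    intro τ
    set υ := ((apPointsBody ρ ω : NCom S V O E).eval 𝓔)^[i] σ with hυ
    have hτ : τ = (apPointsBody ρ ω : NCom S V O E).eval 𝓔 υ := Function.iterate_succ_apply' _ _ _
    clear_value υ
    have hone' : υ.sc (ρ .one) = 1 := (h3 .one (by simp) (by simp) (by simp) (by simp)).trans hone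
    have hn' := h3 .n (by simp) (by simp) (by simp) (by simp)
    have hd' := h3 .d (by simp) (by simp) (by simp) (by simp)
    have hM' := h3 .M (by simp) (by simp) (by simp) (by simp)
    have e : σ.sc (ρ .M) * σ.sc (ρ .d) * (i + 1) = σ.sc (ρ .M) * σ.sc (ρ .d) * i + σ.sc (ρ .M) * σ.sc (ρ .d) := by ring
    rw [hτ]
    refine ⟨?_, ?_, fun r r1 r2 r3 r4 => ?_, fun r hr => ?_, ?_, fun p hp => ?_, ?_, ?_⟩
    · simp [apPointsBody, eval, h1, hone']
    · simp only [apPointsBody, eval, NState.vo_bump, NState.vo_setVo, NState.vo_setSc, NState.sc_setSc, NState.sc_bump, Function.update_apply,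
        EmbeddingLike.apply_eq_iff_eq, reduceCtorEq, ite_true, ite_false, h1, hn', hd', hM', h2, List.append_assoc]
      congr 1
      rw [apPoints, apPoints, List.range_succ, List.map_append, List.map_singleton]
    · simp [apPointsBody, eval, r1, r2, r3, r4, h3 r r1 r2 r3 r4]
    · simp [apPointsBody, eval, hr, h4 r hr]
    · simp [apPointsBody, eval, h5]
    · simp [apPointsBody, eval, hp, h6 p hp]
    · simp only [apPointsBody, eval, NState.peak_bump, NState.peak_setVo, NState.peak_setSc, NState.sc_setSc, NState.sc_setVo, NState.sc_bump,
        Function.update_apply, EmbeddingLike.apply_eq_iff_eq, reduceCtorEq, ite_true, ite_false, h1, hone', hn', hd', hM', Nat.max_zero]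
      generalize σ.sc (ρ .M) * σ.sc (ρ .d) = A at *
      have r1 : A * (i + 1 + 1) = A * (i + 1) + A := by ring
      have r2 : A * (i + 1) = A * i + A := by ring
      clear * - h7 r1 r2
      omega
    · simp [apPointsBody, eval, h8]; ring

/-- The first block `u < i` whose value is not coprime to `N`. [folklore] -/
def blockFirst (N : ℕ) (ws : List ℕ) (i : ℕ) : Option ℕ := (List.range i).find? fun u => 1 < Nat.gcd (ws.getD u 0) N

/-- One more block. [folklore] -/
theorem blockFirst_succ (N : ℕ) (ws : List ℕ) (i : ℕ) :
    blockFirst N ws (i + 1) = (blockFirst N ws i).or (if 1 < Nat.gcd (ws.getD i 0) N then some i else none) := by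
  simp only [blockFirst, List.range_succ, List.find?_append, List.find?_singleton, decide_eq_true_eq]

set_option maxHeartbeats 2000000 in
set_option linter.unusedSimpArgs false in -- one uniform simp set serves the three cases of the round
/-- **Rounds of the block scan**: after `i` rounds, `u = i`, `flag` records whether a block
`< i` was hit and `ublk` the first one. [folklore] -/
theorem apBlock_iterate (σ : NState S V O) (ws : List ℕ) (hREM : σ.vi (ν (.rv .REM)) = ws) (hu : σ.sc (ρ .u) = 0)
    (hone : σ.sc (ρ .one) = 1) (hflag : σ.sc (ρ .flag) = 0) (hublk : σ.sc (ρ .ublk) = 0) (ht : 2 * (σ.sc (ρ .n)).size ≤ σ.sc (ρ (.gc .t))) :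
    ∀ i, i ≤ ws.length → let τ := ((apBlockBody ρ ν : NCom S V O E).eval 𝓔)^[i] σ
      τ.vi (ν (.rv .REM)) = ws.drop i ∧ τ.sc (ρ .u) = i ∧
        τ.sc (ρ .flag) = (if (blockFirst (σ.sc (ρ .n)) ws i).isSome then 1 else 0) ∧ τ.sc (ρ .ublk) = (blockFirst (σ.sc (ρ .n)) ws i).getD 0 ∧
        (∀ r : ApS, r ≠ .u → r ≠ .flag → r ≠ .ublk → r ≠ .gc .a → r ≠ .gc .b → r ≠ .gc .q → r ≠ .gc .r → τ.sc (ρ r) = σ.sc (ρ r)) ∧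
        (∀ r, (∀ i, r ≠ ρ i) → τ.sc r = σ.sc r) ∧ (∀ w, w ≠ ν (.rv .REM) → τ.vi w = σ.vi w) ∧ τ.vo = σ.vo ∧
        τ.peak ≤ max σ.peak i ∧ τ.steps ≤ σ.steps + i * (5 * σ.sc (ρ (.gc .t)) + 8)
  | 0, _ => ⟨by simpa using hREM, hu, by simp [blockFirst, hflag], by simp [blockFirst, hublk], fun _ _ _ _ _ _ _ _ => rfl, fun _ _ => rfl, fun _ _ => rfl,
      rfl, le_max_left _ _, by simp⟩
  | i + 1, hi => by
    obtain ⟨h1, h2, h3, h4, h5, h6, h7, h8, h9, h10⟩ := apBlock_iterate σ ws hREM hu hone hflag hublk ht i (Nat.le_of_succ_le hi)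
    intro τ
    set υ := ((apBlockBody ρ ν : NCom S V O E).eval 𝓔)^[i] σ with hυ
    have hτ : τ = (apBlockBody ρ ν : NCom S V O E).eval 𝓔 υ := Function.iterate_succ_apply' _ _ _
    clear_value υ
    have hone' : υ.sc (ρ .one) = 1 := (h5 .one (by simp) (by simp) (by simp) (by simp) (by simp) (by simp) (by simp)).trans hone
    have hn' := h5 .n (by simp) (by simp) (by simp) (by simp) (by simp) (by simp) (by simp)
    have ht' := h5 (.gc .t) (by simp) (by simp) (by simp) (by simp) (by simp) (by simp) (by simp)
    -- the value of this round
    have hw : (ws.drop i).head? = some (ws.getD i 0) := by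
      rw [List.head?_drop, List.getD_eq_getElem?_getD, List.getElem?_eq_getElem (by omega)]; rfl
    obtain ⟨rest, hrest⟩ : ∃ rest, ws.drop i = ws.getD i 0 :: rest := by
      cases h : ws.drop i with
      | nil => rw [h] at hw; simp at hw
      | cons a l => rw [h, List.head?_cons, Option.some.injEq] at hw; exact ⟨l, by rw [hw]⟩
    have hrest' : rest = ws.drop (i + 1) := by
      have := congr_arg List.tail hrest; simpa [List.tail_drop] using this.symm
    -- after `pop`, `mov`
    set X1 := ((mov (ρ (.gc .b)) (ρ .n) : NCom S V O E)).eval 𝓔 (((pop (ν (.rv .REM)) (ρ (.gc .a)) : NCom S V O E)).eval 𝓔 υ) with hX1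
    have xa : X1.sc (ρ (.gc .a)) = ws.getD i 0 := by simp [hX1, eval, h1, hrest]
    have xb : X1.sc (ρ (.gc .b)) = σ.sc (ρ .n) := by simp [hX1, eval, hn']
    have xr : ∀ r : ApS, r ≠ .gc .a → r ≠ .gc .b → X1.sc (ρ r) = υ.sc (ρ r) := fun r r1 r2 => by simp [hX1, eval, r1, r2]
    have xo : ∀ r, (∀ i, r ≠ ρ i) → X1.sc r = υ.sc r := fun r hr => by simp [hX1, eval, hr]
    have xv : ∀ w, w ≠ ν (.rv .REM) → X1.vi w = υ.vi w := fun w hw => by simp [hX1, eval, hw]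
    have xREM : X1.vi (ν (.rv .REM)) = ws.drop (i + 1) := by simp [hX1, eval, h1, hrest, hrest']
    have xvo : X1.vo = υ.vo := by simp [hX1, eval]
    have xpk : X1.peak = υ.peak := by simp [hX1, eval]
    have xst : X1.steps = υ.steps + 2 := by simp [hX1, eval]
    have xt : X1.sc (ρ (.gc .t)) = σ.sc (ρ (.gc .t)) := (xr _ (by simp) (by simp)).trans ht'
    obtain ⟨g1, g2, g3, g4, g5, g6, g7⟩ := gcdP_spec 𝓔 (ApS.gcE.trans ρ) X1 (by show 2 * (X1.sc (ρ (.gc .b))).size ≤ X1.sc (ρ (.gc .t)); rw [xb, xt]; exact ht)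
    set G := (gcdP (ApS.gcE.trans ρ) : NCom S V O E).eval 𝓔 X1 with hG
    simp only [Function.Embedding.trans_apply, ApS.gcE_apply] at g1 g2 g3 g7
    rw [xa, xb] at g1
    rw [xt] at g7
    have gx : ∀ r : ApS, r ≠ .gc .a → r ≠ .gc .b → r ≠ .gc .q → r ≠ .gc .r → G.sc (ρ r) = X1.sc (ρ r) :=
      fun r r1 r2 r3 r4 => g3 _ (by simpa using r1) (by simpa using r2) (by simpa using r3) (by simpa using r4)
    have gone : G.sc (ρ .one) = 1 := by rw [gx .one (by simp) (by simp) (by simp) (by simp), xr .one (by simp) (by simp)]; exact hone'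
    have gu : G.sc (ρ .u) = i := by rw [gx .u (by simp) (by simp) (by simp) (by simp), xr .u (by simp) (by simp)]; exact h2
    have gflag : G.sc (ρ .flag) = if (blockFirst (σ.sc (ρ .n)) ws i).isSome then 1 else 0 := by
      rw [gx .flag (by simp) (by simp) (by simp) (by simp), xr .flag (by simp) (by simp)]; exact h3
    have gublk : G.sc (ρ .ublk) = (blockFirst (σ.sc (ρ .n)) ws i).getD 0 := by
      rw [gx .ublk (by simp) (by simp) (by simp) (by simp), xr .ublk (by simp) (by simp)]; exact h4
    have gREM : G.vi (ν (.rv .REM)) = ws.drop (i + 1) := by rw [g4]; exact xREM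
    have gfr : ∀ r : ApS, r ≠ .u → r ≠ .flag → r ≠ .ublk → r ≠ .gc .a → r ≠ .gc .b → r ≠ .gc .q → r ≠ .gc .r → G.sc (ρ r) = σ.sc (ρ r) :=
      fun r r1 r2 r3 r4 r5 r6 r7 => by rw [gx r r4 r5 r6 r7, xr r r4 r5]; exact h5 r r1 r2 r3 r4 r5 r6 r7
    have gor : ∀ r, (∀ i, r ≠ ρ i) → G.sc r = σ.sc r := fun r hr => by
      rw [g3 r (hr _) (hr _) (hr _) (hr _), xo r hr]; exact h6 r hr
    have gvi : ∀ w, w ≠ ν (.rv .REM) → G.vi w = σ.vi w := fun w hw => by rw [g4, xv w hw]; exact h7 w hw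
    have gvo : G.vo = σ.vo := by rw [g5, xvo]; exact h8
    have gpk : G.peak ≤ max σ.peak i := by rw [g6, xpk]; exact h9
    have gst : G.steps ≤ σ.steps + i * (5 * σ.sc (ρ (.gc .t)) + 8) + 5 * σ.sc (ρ (.gc .t)) + 3 := by rw [xst] at g7; omega
    have hτ' : τ = ((ifLt (ρ .one) (ρ (.gc .a)) (ifPos (ρ .flag) skip (mov (ρ .ublk) (ρ .u) ;ₙ setc (ρ .flag) 1)) skip ;ₙ add (ρ .u) (ρ .u) (ρ .one) :
        NCom S V O E)).eval 𝓔 G := by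
      rw [hτ]; simp only [apBlockBody, eval_seq, hG, hX1]
    clear_value X1 G
    rw [hτ', blockFirst_succ]
    -- the three cases of the round
    by_cases hhit : 1 < Nat.gcd (ws.getD i 0) (σ.sc (ρ .n))
    · by_cases hfl : (blockFirst (σ.sc (ρ .n)) ws i).isSome
      · obtain ⟨u0, hu0⟩ := Option.isSome_iff_exists.1 hfl
        rw [hu0] at gflag gublk ⊢
        simp only [Option.isSome_some, if_true, Option.getD_some] at gflag gublk
        refine ⟨?_, ?_, ?_, ?_, fun r r1 r2 r3 r4 r5 r6 r7 => ?_, fun r hr => ?_, fun w hw' => ?_, ?_, ?_, ?_⟩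
        · simp only [eval_seq, eval, gone, g1, hhit, gu, gREM, gflag, gublk, NState.sc_bump, NState.vi_bump, NState.vo_bump, NState.peak_bump, NState.steps_bump, NState.sc_setSc, NState.vi_setSc, NState.vo_setSc, NState.peak_setSc, NState.steps_setSc, Function.update_apply, EmbeddingLike.apply_eq_iff_eq, reduceCtorEq, ite_true, ite_false, Nat.max_zero, lt_self_iff_false, Nat.one_pos, Nat.lt_irrefl]
        · simp only [eval_seq, eval, gone, g1, hhit, gu, gREM, gflag, gublk, NState.sc_bump, NState.vi_bump, NState.vo_bump, NState.peak_bump, NState.steps_bump, NState.sc_setSc, NState.vi_setSc, NState.vo_setSc, NState.peak_setSc, NState.steps_setSc, Function.update_apply, EmbeddingLike.apply_eq_iff_eq, reduceCtorEq, ite_true, ite_false, Nat.max_zero, lt_self_iff_false, Nat.one_pos, Nat.lt_irrefl]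
        · simp only [eval_seq, eval, gone, g1, hhit, gu, gREM, gflag, gublk, NState.sc_bump, NState.vi_bump, NState.vo_bump, NState.peak_bump, NState.steps_bump, NState.sc_setSc, NState.vi_setSc, NState.vo_setSc, NState.peak_setSc, NState.steps_setSc, Function.update_apply, EmbeddingLike.apply_eq_iff_eq, reduceCtorEq, ite_true, ite_false, Nat.max_zero, lt_self_iff_false, Nat.one_pos, Nat.lt_irrefl]; simp
        · simp only [eval_seq, eval, gone, g1, hhit, gu, gREM, gflag, gublk, NState.sc_bump, NState.vi_bump, NState.vo_bump, NState.peak_bump, NState.steps_bump, NState.sc_setSc, NState.vi_setSc, NState.vo_setSc, NState.peak_setSc, NState.steps_setSc, Function.update_apply, EmbeddingLike.apply_eq_iff_eq, reduceCtorEq, ite_true, ite_false, Nat.max_zero, lt_self_iff_false, Nat.one_pos, Nat.lt_irrefl]; simp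
        · simp only [eval_seq, eval, gone, g1, hhit, gu, gREM, gflag, gublk, NState.sc_bump, NState.vi_bump, NState.vo_bump, NState.peak_bump, NState.steps_bump, NState.sc_setSc, NState.vi_setSc, NState.vo_setSc, NState.peak_setSc, NState.steps_setSc, Function.update_apply, EmbeddingLike.apply_eq_iff_eq, reduceCtorEq, ite_true, ite_false, Nat.max_zero, lt_self_iff_false, Nat.one_pos, Nat.lt_irrefl, r1, r2, r3, gfr r r1 r2 r3 r4 r5 r6 r7]
        · simp only [eval_seq, eval, gone, g1, hhit, gu, gREM, gflag, gublk, NState.sc_bump, NState.vi_bump, NState.vo_bump, NState.peak_bump, NState.steps_bump, NState.sc_setSc, NState.vi_setSc, NState.vo_setSc, NState.peak_setSc, NState.steps_setSc, Function.update_apply, EmbeddingLike.apply_eq_iff_eq, reduceCtorEq, ite_true, ite_false, Nat.max_zero, lt_self_iff_false, Nat.one_pos, Nat.lt_irrefl, hr, gor r hr]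
        · simp only [eval_seq, eval, gone, g1, hhit, gu, gREM, gflag, gublk, NState.sc_bump, NState.vi_bump, NState.vo_bump, NState.peak_bump, NState.steps_bump, NState.sc_setSc, NState.vi_setSc, NState.vo_setSc, NState.peak_setSc, NState.steps_setSc, Function.update_apply, EmbeddingLike.apply_eq_iff_eq, reduceCtorEq, ite_true, ite_false, Nat.max_zero, lt_self_iff_false, Nat.one_pos, Nat.lt_irrefl, gvi w hw']
        · simp only [eval_seq, eval, gone, g1, hhit, gu, gREM, gflag, gublk, NState.sc_bump, NState.vi_bump, NState.vo_bump, NState.peak_bump, NState.steps_bump, NState.sc_setSc, NState.vi_setSc, NState.vo_setSc, NState.peak_setSc, NState.steps_setSc, Function.update_apply, EmbeddingLike.apply_eq_iff_eq, reduceCtorEq, ite_true, ite_false, Nat.max_zero, lt_self_iff_false, Nat.one_pos, Nat.lt_irrefl, gvo]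
        · simp only [eval_seq, eval, gone, g1, hhit, gu, gREM, gflag, gublk, NState.sc_bump, NState.vi_bump, NState.vo_bump, NState.peak_bump, NState.steps_bump, NState.sc_setSc, NState.vi_setSc, NState.vo_setSc, NState.peak_setSc, NState.steps_setSc, Function.update_apply, EmbeddingLike.apply_eq_iff_eq, reduceCtorEq, ite_true, ite_false, Nat.max_zero, lt_self_iff_false, Nat.one_pos, Nat.lt_irrefl]; clear * - gpk; omega
        · simp only [eval_seq, eval, gone, g1, hhit, gu, gREM, gflag, gublk, NState.sc_bump, NState.vi_bump, NState.vo_bump, NState.peak_bump, NState.steps_bump, NState.sc_setSc, NState.vi_setSc, NState.vo_setSc, NState.peak_setSc, NState.steps_setSc, Function.update_apply, EmbeddingLike.apply_eq_iff_eq, reduceCtorEq, ite_true, ite_false, Nat.max_zero, lt_self_iff_false, Nat.one_pos, Nat.lt_irrefl]; rw [Nat.succ_mul]; clear * - gst; omega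
      · rw [Option.not_isSome_iff_eq_none] at hfl
        rw [hfl] at gflag gublk ⊢
        simp only [Option.isSome_none, Option.getD_none] at gflag gublk
        refine ⟨?_, ?_, ?_, ?_, fun r r1 r2 r3 r4 r5 r6 r7 => ?_, fun r hr => ?_, fun w hw' => ?_, ?_, ?_, ?_⟩
        · simp only [eval_seq, eval, gone, g1, hhit, gu, gREM, gflag, gublk, NState.sc_bump, NState.vi_bump, NState.vo_bump, NState.peak_bump, NState.steps_bump, NState.sc_setSc, NState.vi_setSc, NState.vo_setSc, NState.peak_setSc, NState.steps_setSc, Function.update_apply, EmbeddingLike.apply_eq_iff_eq, reduceCtorEq, ite_true, ite_false, Nat.max_zero, lt_self_iff_false, Nat.one_pos, Nat.lt_irrefl]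
        · simp only [eval_seq, eval, gone, g1, hhit, gu, gREM, gflag, gublk, NState.sc_bump, NState.vi_bump, NState.vo_bump, NState.peak_bump, NState.steps_bump, NState.sc_setSc, NState.vi_setSc, NState.vo_setSc, NState.peak_setSc, NState.steps_setSc, Function.update_apply, EmbeddingLike.apply_eq_iff_eq, reduceCtorEq, ite_true, ite_false, Nat.max_zero, lt_self_iff_false, Nat.one_pos, Nat.lt_irrefl]
        · simp only [eval_seq, eval, gone, g1, hhit, gu, gREM, gflag, gublk, NState.sc_bump, NState.vi_bump, NState.vo_bump, NState.peak_bump, NState.steps_bump, NState.sc_setSc, NState.vi_setSc, NState.vo_setSc, NState.peak_setSc, NState.steps_setSc, Function.update_apply, EmbeddingLike.apply_eq_iff_eq, reduceCtorEq, ite_true, ite_false, Nat.max_zero, lt_self_iff_false, Nat.one_pos, Nat.lt_irrefl]; simp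
        · simp only [eval_seq, eval, gone, g1, hhit, gu, gREM, gflag, gublk, NState.sc_bump, NState.vi_bump, NState.vo_bump, NState.peak_bump, NState.steps_bump, NState.sc_setSc, NState.vi_setSc, NState.vo_setSc, NState.peak_setSc, NState.steps_setSc, Function.update_apply, EmbeddingLike.apply_eq_iff_eq, reduceCtorEq, ite_true, ite_false, Nat.max_zero, lt_self_iff_false, Nat.one_pos, Nat.lt_irrefl]; simp
        · simp only [eval_seq, eval, gone, g1, hhit, gu, gREM, gflag, gublk, NState.sc_bump, NState.vi_bump, NState.vo_bump, NState.peak_bump, NState.steps_bump, NState.sc_setSc, NState.vi_setSc, NState.vo_setSc, NState.peak_setSc, NState.steps_setSc, Function.update_apply, EmbeddingLike.apply_eq_iff_eq, reduceCtorEq, ite_true, ite_false, Nat.max_zero, lt_self_iff_false, Nat.one_pos, Nat.lt_irrefl, r1, r2, r3, gfr r r1 r2 r3 r4 r5 r6 r7]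
        · simp only [eval_seq, eval, gone, g1, hhit, gu, gREM, gflag, gublk, NState.sc_bump, NState.vi_bump, NState.vo_bump, NState.peak_bump, NState.steps_bump, NState.sc_setSc, NState.vi_setSc, NState.vo_setSc, NState.peak_setSc, NState.steps_setSc, Function.update_apply, EmbeddingLike.apply_eq_iff_eq, reduceCtorEq, ite_true, ite_false, Nat.max_zero, lt_self_iff_false, Nat.one_pos, Nat.lt_irrefl, hr, gor r hr]
        · simp only [eval_seq, eval, gone, g1, hhit, gu, gREM, gflag, gublk, NState.sc_bump, NState.vi_bump, NState.vo_bump, NState.peak_bump, NState.steps_bump, NState.sc_setSc, NState.vi_setSc, NState.vo_setSc, NState.peak_setSc, NState.steps_setSc, Function.update_apply, EmbeddingLike.apply_eq_iff_eq, reduceCtorEq, ite_true, ite_false, Nat.max_zero, lt_self_iff_false, Nat.one_pos, Nat.lt_irrefl, gvi w hw']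
        · simp only [eval_seq, eval, gone, g1, hhit, gu, gREM, gflag, gublk, NState.sc_bump, NState.vi_bump, NState.vo_bump, NState.peak_bump, NState.steps_bump, NState.sc_setSc, NState.vi_setSc, NState.vo_setSc, NState.peak_setSc, NState.steps_setSc, Function.update_apply, EmbeddingLike.apply_eq_iff_eq, reduceCtorEq, ite_true, ite_false, Nat.max_zero, lt_self_iff_false, Nat.one_pos, Nat.lt_irrefl, gvo]
        · simp only [eval_seq, eval, gone, g1, hhit, gu, gREM, gflag, gublk, NState.sc_bump, NState.vi_bump, NState.vo_bump, NState.peak_bump, NState.steps_bump, NState.sc_setSc, NState.vi_setSc, NState.vo_setSc, NState.peak_setSc, NState.steps_setSc, Function.update_apply, EmbeddingLike.apply_eq_iff_eq, reduceCtorEq, ite_true, ite_false, Nat.max_zero, lt_self_iff_false, Nat.one_pos, Nat.lt_irrefl]; clear * - gpk; omega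
        · simp only [eval_seq, eval, gone, g1, hhit, gu, gREM, gflag, gublk, NState.sc_bump, NState.vi_bump, NState.vo_bump, NState.peak_bump, NState.steps_bump, NState.sc_setSc, NState.vi_setSc, NState.vo_setSc, NState.peak_setSc, NState.steps_setSc, Function.update_apply, EmbeddingLike.apply_eq_iff_eq, reduceCtorEq, ite_true, ite_false, Nat.max_zero, lt_self_iff_false, Nat.one_pos, Nat.lt_irrefl]; rw [Nat.succ_mul]; clear * - gst; omega
    · have gflag' := gflag
      have gublk' := gublk
      refine ⟨?_, ?_, ?_, ?_, fun r r1 r2 r3 r4 r5 r6 r7 => ?_, fun r hr => ?_, fun w hw' => ?_, ?_, ?_, ?_⟩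
      · simp only [eval_seq, eval, gone, g1, hhit, gu, gREM, gflag, gublk, NState.sc_bump, NState.vi_bump, NState.vo_bump, NState.peak_bump, NState.steps_bump, NState.sc_setSc, NState.vi_setSc, NState.vo_setSc, NState.peak_setSc, NState.steps_setSc, Function.update_apply, EmbeddingLike.apply_eq_iff_eq, reduceCtorEq, ite_true, ite_false, Nat.max_zero, lt_self_iff_false, Nat.one_pos, Nat.lt_irrefl]
      · simp only [eval_seq, eval, gone, g1, hhit, gu, gREM, gflag, gublk, NState.sc_bump, NState.vi_bump, NState.vo_bump, NState.peak_bump, NState.steps_bump, NState.sc_setSc, NState.vi_setSc, NState.vo_setSc, NState.peak_setSc, NState.steps_setSc, Function.update_apply, EmbeddingLike.apply_eq_iff_eq, reduceCtorEq, ite_true, ite_false, Nat.max_zero, lt_self_iff_false, Nat.one_pos, Nat.lt_irrefl]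
      · simp only [eval_seq, eval, gone, g1, hhit, gu, gREM, gflag, gublk, NState.sc_bump, NState.vi_bump, NState.vo_bump, NState.peak_bump, NState.steps_bump, NState.sc_setSc, NState.vi_setSc, NState.vo_setSc, NState.peak_setSc, NState.steps_setSc, Function.update_apply, EmbeddingLike.apply_eq_iff_eq, reduceCtorEq, ite_true, ite_false, Nat.max_zero, lt_self_iff_false, Nat.one_pos, Nat.lt_irrefl]; simp
      · simp only [eval_seq, eval, gone, g1, hhit, gu, gREM, gflag, gublk, NState.sc_bump, NState.vi_bump, NState.vo_bump, NState.peak_bump, NState.steps_bump, NState.sc_setSc, NState.vi_setSc, NState.vo_setSc, NState.peak_setSc, NState.steps_setSc, Function.update_apply, EmbeddingLike.apply_eq_iff_eq, reduceCtorEq, ite_true, ite_false, Nat.max_zero, lt_self_iff_false, Nat.one_pos, Nat.lt_irrefl]; simp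
      · simp only [eval_seq, eval, gone, g1, hhit, gu, gREM, gflag, gublk, NState.sc_bump, NState.vi_bump, NState.vo_bump, NState.peak_bump, NState.steps_bump, NState.sc_setSc, NState.vi_setSc, NState.vo_setSc, NState.peak_setSc, NState.steps_setSc, Function.update_apply, EmbeddingLike.apply_eq_iff_eq, reduceCtorEq, ite_true, ite_false, Nat.max_zero, lt_self_iff_false, Nat.one_pos, Nat.lt_irrefl, r1, r2, r3, gfr r r1 r2 r3 r4 r5 r6 r7]
      · simp only [eval_seq, eval, gone, g1, hhit, gu, gREM, gflag, gublk, NState.sc_bump, NState.vi_bump, NState.vo_bump, NState.peak_bump, NState.steps_bump, NState.sc_setSc, NState.vi_setSc, NState.vo_setSc, NState.peak_setSc, NState.steps_setSc, Function.update_apply, EmbeddingLike.apply_eq_iff_eq, reduceCtorEq, ite_true, ite_false, Nat.max_zero, lt_self_iff_false, Nat.one_pos, Nat.lt_irrefl, hr, gor r hr]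
      · simp only [eval_seq, eval, gone, g1, hhit, gu, gREM, gflag, gublk, NState.sc_bump, NState.vi_bump, NState.vo_bump, NState.peak_bump, NState.steps_bump, NState.sc_setSc, NState.vi_setSc, NState.vo_setSc, NState.peak_setSc, NState.steps_setSc, Function.update_apply, EmbeddingLike.apply_eq_iff_eq, reduceCtorEq, ite_true, ite_false, Nat.max_zero, lt_self_iff_false, Nat.one_pos, Nat.lt_irrefl, gvi w hw']
      · simp only [eval_seq, eval, gone, g1, hhit, gu, gREM, gflag, gublk, NState.sc_bump, NState.vi_bump, NState.vo_bump, NState.peak_bump, NState.steps_bump, NState.sc_setSc, NState.vi_setSc, NState.vo_setSc, NState.peak_setSc, NState.steps_setSc, Function.update_apply, EmbeddingLike.apply_eq_iff_eq, reduceCtorEq, ite_true, ite_false, Nat.max_zero, lt_self_iff_false, Nat.one_pos, Nat.lt_irrefl, gvo]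
      · simp only [eval_seq, eval, gone, g1, hhit, gu, gREM, gflag, gublk, NState.sc_bump, NState.vi_bump, NState.vo_bump, NState.peak_bump, NState.steps_bump, NState.sc_setSc, NState.vi_setSc, NState.vo_setSc, NState.peak_setSc, NState.steps_setSc, Function.update_apply, EmbeddingLike.apply_eq_iff_eq, reduceCtorEq, ite_true, ite_false, Nat.max_zero, lt_self_iff_false, Nat.one_pos, Nat.lt_irrefl]; clear * - gpk; omega
      · simp only [eval_seq, eval, gone, g1, hhit, gu, gREM, gflag, gublk, NState.sc_bump, NState.vi_bump, NState.vo_bump, NState.peak_bump, NState.steps_bump, NState.sc_setSc, NState.vi_setSc, NState.vo_setSc, NState.peak_setSc, NState.steps_setSc, Function.update_apply, EmbeddingLike.apply_eq_iff_eq, reduceCtorEq, ite_true, ite_false, Nat.max_zero, lt_self_iff_false, Nat.one_pos, Nat.lt_irrefl]; rw [Nat.succ_mul]; clear * - gst; omega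

/-- The first candidate `j < i` of the block that is not coprime to `N`. [folklore] -/
def candFirst (N s M ublk d : ℕ) (i : ℕ) : Option ℕ := (List.range i).find? fun j => 1 < Nat.gcd (apCand s M (ublk * d + (j + 1))) N

/-- One more candidate. [folklore] -/
theorem candFirst_succ (N s M ublk d i : ℕ) :
    candFirst N s M ublk d (i + 1) = (candFirst N s M ublk d i).or (if 1 < Nat.gcd (apCand s M (ublk * d + (i + 1))) N then some i else none) := by
  simp only [candFirst, List.range_succ, List.find?_append, List.find?_singleton, decide_eq_true_eq]

set_option maxHeartbeats 2000000 in
set_option linter.unusedSimpArgs false in -- one uniform simp set serves the three cases of the round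
/-- **Rounds of the candidate scan**: after `i` rounds, `j = i`, `found` records whether a
candidate `< i` was hit and `kout` the first one (as `ublk d + j + 1`). [folklore] -/
theorem apCand_iterate (σ : NState S V O) (hj : σ.sc (ρ .j) = 0) (hone : σ.sc (ρ .one) = 1) (hfound : σ.sc (ρ .found) = 0) (hkout : σ.sc (ρ .kout) = 0)
    (ht : 2 * (σ.sc (ρ .n)).size ≤ σ.sc (ρ (.gc .t))) :
    ∀ i, let τ := ((apCandBody ρ : NCom S V O E).eval 𝓔)^[i] σ
      let c := candFirst (σ.sc (ρ .n)) (σ.sc (ρ .s)) (σ.sc (ρ .M)) (σ.sc (ρ .ublk)) (σ.sc (ρ .d)) i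
      τ.sc (ρ .j) = i ∧ τ.sc (ρ .found) = (if c.isSome then 1 else 0) ∧ τ.sc (ρ .kout) = (c.map fun j0 => σ.sc (ρ .ublk) * σ.sc (ρ .d) + (j0 + 1)).getD 0 ∧
        (∀ r : ApS, r ≠ .j → r ≠ .tmp → r ≠ .found → r ≠ .kout → r ≠ .gc .a → r ≠ .gc .b → r ≠ .gc .q → r ≠ .gc .r → τ.sc (ρ r) = σ.sc (ρ r)) ∧
        (∀ r, (∀ i, r ≠ ρ i) → τ.sc r = σ.sc r) ∧ τ.vi = σ.vi ∧ τ.vo = σ.vo ∧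
        τ.peak ≤ max σ.peak (i + σ.sc (ρ .ublk) * σ.sc (ρ .d) + σ.sc (ρ .M) * (σ.sc (ρ .ublk) * σ.sc (ρ .d) + i) + σ.sc (ρ .s)) ∧
        τ.steps ≤ σ.steps + i * (5 * σ.sc (ρ (.gc .t)) + 12)
  | 0 => ⟨hj, by simp [candFirst, hfound], by simp [candFirst, hkout], fun _ _ _ _ _ _ _ _ _ => rfl, fun _ _ => rfl, rfl, rfl, le_max_left _ _, by simp⟩
  | i + 1 => by
    obtain ⟨h1, h2, h3, h4, h5, h6, h7, h8, h9⟩ := apCand_iterate σ hj hone hfound hkout ht i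
    intro τ c
    set υ := ((apCandBody ρ : NCom S V O E).eval 𝓔)^[i] σ with hυ
    have hτ : τ = (apCandBody ρ : NCom S V O E).eval 𝓔 υ := Function.iterate_succ_apply' _ _ _
    clear_value υ
    have fr := fun (r : ApS) (r1 : r ≠ .j) (r2 : r ≠ .tmp) (r3 : r ≠ .found) (r4 : r ≠ .kout) (r5 : r ≠ .gc .a) (r6 : r ≠ .gc .b) (r7 : r ≠ .gc .q)
      (r8 : r ≠ .gc .r) => h4 r r1 r2 r3 r4 r5 r6 r7 r8
    have hone' : υ.sc (ρ .one) = 1 := (fr .one (by simp) (by simp) (by simp) (by simp) (by simp) (by simp) (by simp) (by simp)).trans hone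
    have hn' := fr .n (by simp) (by simp) (by simp) (by simp) (by simp) (by simp) (by simp) (by simp)
    have ht' := fr (.gc .t) (by simp) (by simp) (by simp) (by simp) (by simp) (by simp) (by simp) (by simp)
    have hs' := fr .s (by simp) (by simp) (by simp) (by simp) (by simp) (by simp) (by simp) (by simp)
    have hM' := fr .M (by simp) (by simp) (by simp) (by simp) (by simp) (by simp) (by simp) (by simp)
    have hd' := fr .d (by simp) (by simp) (by simp) (by simp) (by simp) (by simp) (by simp) (by simp)
    have hub' := fr .ublk (by simp) (by simp) (by simp) (by simp) (by simp) (by simp) (by simp) (by simp)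
    set cand := apCand (σ.sc (ρ .s)) (σ.sc (ρ .M)) (σ.sc (ρ .ublk) * σ.sc (ρ .d) + (i + 1)) with hcand'
    have hcand : cand = σ.sc (ρ .s) + σ.sc (ρ .M) * (σ.sc (ρ .ublk) * σ.sc (ρ .d) + (i + 1)) := rfl
    -- the six straight-line instructions
    set X1 := ((mov (ρ (.gc .b)) (ρ .n) : NCom S V O E)).eval 𝓔 (((add (ρ (.gc .a)) (ρ (.gc .a)) (ρ .s) : NCom S V O E)).eval 𝓔
      (((mul (ρ (.gc .a)) (ρ .M) (ρ .tmp) : NCom S V O E)).eval 𝓔 (((add (ρ .tmp) (ρ .tmp) (ρ .j) : NCom S V O E)).eval 𝓔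
      (((mul (ρ .tmp) (ρ .ublk) (ρ .d) : NCom S V O E)).eval 𝓔 (((add (ρ .j) (ρ .j) (ρ .one) : NCom S V O E)).eval 𝓔 υ))))) with hX1
    have xa : X1.sc (ρ (.gc .a)) = cand := by simp [hX1, eval, h1, hone', hs', hM', hd', hub', hcand]; ring
    have xb : X1.sc (ρ (.gc .b)) = σ.sc (ρ .n) := by simp [hX1, eval, hn']
    have xj : X1.sc (ρ .j) = i + 1 := by simp [hX1, eval, h1, hone']
    have xtmp : X1.sc (ρ .tmp) = σ.sc (ρ .ublk) * σ.sc (ρ .d) + (i + 1) := by simp [hX1, eval, h1, hone', hd', hub']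
    have xr : ∀ r : ApS, r ≠ .j → r ≠ .tmp → r ≠ .gc .a → r ≠ .gc .b → X1.sc (ρ r) = υ.sc (ρ r) := fun r r1 r2 r3 r4 => by simp [hX1, eval, r1, r2, r3, r4]
    have xo : ∀ r, (∀ i, r ≠ ρ i) → X1.sc r = υ.sc r := fun r hr => by simp [hX1, eval, hr]
    have xvi : X1.vi = υ.vi := by simp [hX1, eval]
    have xvo : X1.vo = υ.vo := by simp [hX1, eval]
    have xpk : X1.peak ≤ max υ.peak ((i + 1) + σ.sc (ρ .ublk) * σ.sc (ρ .d) + cand) := by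
      simp only [hX1, eval, NState.peak_bump, NState.peak_setSc, NState.sc_bump, NState.sc_setSc, Function.update_apply, EmbeddingLike.apply_eq_iff_eq,
        reduceCtorEq, ite_true, ite_false, h1, hone', hs', hM', hd', hub', Nat.max_zero, hcand]
      have e : σ.sc (ρ .M) * (σ.sc (ρ .ublk) * σ.sc (ρ .d) + (i + 1)) = σ.sc (ρ .M) * (σ.sc (ρ .ublk) * σ.sc (ρ .d)) + σ.sc (ρ .M) * (i + 1) := by ring
      generalize σ.sc (ρ .ublk) * σ.sc (ρ .d) = A at *
      generalize σ.sc (ρ .M) * (A + (i + 1)) = B at *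
      clear * -
      omega
    have xst : X1.steps = υ.steps + 6 := by simp [hX1, eval]
    have xt : X1.sc (ρ (.gc .t)) = σ.sc (ρ (.gc .t)) := (xr _ (by simp) (by simp) (by simp) (by simp)).trans ht'
    obtain ⟨g1, g2, g3, g4, g5, g6, g7⟩ := gcdP_spec 𝓔 (ApS.gcE.trans ρ) X1 (by show 2 * (X1.sc (ρ (.gc .b))).size ≤ X1.sc (ρ (.gc .t)); rw [xb, xt]; exact ht)
    set G := (gcdP (ApS.gcE.trans ρ) : NCom S V O E).eval 𝓔 X1 with hG
    simp only [Function.Embedding.trans_apply, ApS.gcE_apply] at g1 g2 g3 g7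
    rw [xa, xb] at g1
    rw [xt] at g7
    have gx : ∀ r : ApS, r ≠ .gc .a → r ≠ .gc .b → r ≠ .gc .q → r ≠ .gc .r → G.sc (ρ r) = X1.sc (ρ r) :=
      fun r r1 r2 r3 r4 => g3 _ (by simpa using r1) (by simpa using r2) (by simpa using r3) (by simpa using r4)
    have gone : G.sc (ρ .one) = 1 := by rw [gx .one (by simp) (by simp) (by simp) (by simp), xr .one (by simp) (by simp) (by simp) (by simp)]; exact hone'
    have gj : G.sc (ρ .j) = i + 1 := by rw [gx .j (by simp) (by simp) (by simp) (by simp)]; exact xj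
    have gtmp : G.sc (ρ .tmp) = σ.sc (ρ .ublk) * σ.sc (ρ .d) + (i + 1) := by rw [gx .tmp (by simp) (by simp) (by simp) (by simp)]; exact xtmp
    have gfound : G.sc (ρ .found) = if (candFirst (σ.sc (ρ .n)) (σ.sc (ρ .s)) (σ.sc (ρ .M)) (σ.sc (ρ .ublk)) (σ.sc (ρ .d)) i).isSome then 1 else 0 := by
      rw [gx .found (by simp) (by simp) (by simp) (by simp), xr .found (by simp) (by simp) (by simp) (by simp)]; exact h2
    have gkout : G.sc (ρ .kout) = ((candFirst (σ.sc (ρ .n)) (σ.sc (ρ .s)) (σ.sc (ρ .M)) (σ.sc (ρ .ublk)) (σ.sc (ρ .d)) i).map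
        fun j0 => σ.sc (ρ .ublk) * σ.sc (ρ .d) + (j0 + 1)).getD 0 := by
      rw [gx .kout (by simp) (by simp) (by simp) (by simp), xr .kout (by simp) (by simp) (by simp) (by simp)]; exact h3
    have gfr : ∀ r : ApS, r ≠ .j → r ≠ .tmp → r ≠ .found → r ≠ .kout → r ≠ .gc .a → r ≠ .gc .b → r ≠ .gc .q → r ≠ .gc .r → G.sc (ρ r) = σ.sc (ρ r) :=
      fun r r1 r2 r3 r4 r5 r6 r7 r8 => by rw [gx r r5 r6 r7 r8, xr r r1 r2 r5 r6]; exact h4 r r1 r2 r3 r4 r5 r6 r7 r8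
    have gor : ∀ r, (∀ i, r ≠ ρ i) → G.sc r = σ.sc r := fun r hr => by
      rw [g3 r (hr _) (hr _) (hr _) (hr _), xo r hr]; exact h5 r hr
    have gvi : G.vi = σ.vi := by rw [g4, xvi]; exact h6
    have gvo : G.vo = σ.vo := by rw [g5, xvo]; exact h7
    have gpk : G.peak ≤ max σ.peak ((i + 1) + σ.sc (ρ .ublk) * σ.sc (ρ .d) + cand) := by
      rw [g6]; refine xpk.trans (max_le (h8.trans (max_le (le_max_left _ _) (le_max_of_le_right ?_))) (le_max_right _ _))
      rw [hcand]; nlinarith [Nat.zero_le (σ.sc (ρ .M))]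
    have gst : G.steps ≤ σ.steps + i * (5 * σ.sc (ρ (.gc .t)) + 12) + 5 * σ.sc (ρ (.gc .t)) + 7 := by rw [xst] at g7; omega
    have hτ' : τ = ((ifLt (ρ .one) (ρ (.gc .a)) (ifPos (ρ .found) skip (mov (ρ .kout) (ρ .tmp) ;ₙ setc (ρ .found) 1)) skip : NCom S V O E)).eval 𝓔 G := by
      rw [hτ]; simp only [apCandBody, eval_seq, hG, hX1]
    clear_value X1 G
    simp only [c, candFirst_succ]
    rw [hτ', ← hcand']
    -- the three cases of the round
    by_cases hhit : 1 < Nat.gcd cand (σ.sc (ρ .n))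
    · by_cases hfl : (candFirst (σ.sc (ρ .n)) (σ.sc (ρ .s)) (σ.sc (ρ .M)) (σ.sc (ρ .ublk)) (σ.sc (ρ .d)) i).isSome
      · obtain ⟨j0, hj0⟩ := Option.isSome_iff_exists.1 hfl
        rw [hj0] at gfound gkout ⊢
        simp only [Option.isSome_some, if_true, Option.map_some, Option.getD_some] at gfound gkout
        refine ⟨?_, ?_, ?_, fun r r1 r2 r3 r4 r5 r6 r7 r8 => ?_, fun r hr => ?_, ?_, ?_, ?_, ?_⟩
        · simp only [eval_seq, eval, gone, g1, hhit, gj, gtmp, gfound, gkout, NState.sc_bump, NState.vi_bump, NState.vo_bump, NState.peak_bump, NState.steps_bump, NState.sc_setSc, NState.vi_setSc, NState.vo_setSc, NState.peak_setSc, NState.steps_setSc, Function.update_apply, EmbeddingLike.apply_eq_iff_eq, reduceCtorEq, ite_true, ite_false, Nat.max_zero, lt_self_iff_false, Nat.one_pos, Nat.lt_irrefl]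
        · simp only [eval_seq, eval, gone, g1, hhit, gj, gtmp, gfound, gkout, NState.sc_bump, NState.vi_bump, NState.vo_bump, NState.peak_bump, NState.steps_bump, NState.sc_setSc, NState.vi_setSc, NState.vo_setSc, NState.peak_setSc, NState.steps_setSc, Function.update_apply, EmbeddingLike.apply_eq_iff_eq, reduceCtorEq, ite_true, ite_false, Nat.max_zero, lt_self_iff_false, Nat.one_pos, Nat.lt_irrefl]; simp
        · simp only [eval_seq, eval, gone, g1, hhit, gj, gtmp, gfound, gkout, NState.sc_bump, NState.vi_bump, NState.vo_bump, NState.peak_bump, NState.steps_bump, NState.sc_setSc, NState.vi_setSc, NState.vo_setSc, NState.peak_setSc, NState.steps_setSc, Function.update_apply, EmbeddingLike.apply_eq_iff_eq, reduceCtorEq, ite_true, ite_false, Nat.max_zero, lt_self_iff_false, Nat.one_pos, Nat.lt_irrefl]; simp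
        · simp only [eval_seq, eval, gone, g1, hhit, gj, gtmp, gfound, gkout, NState.sc_bump, NState.vi_bump, NState.vo_bump, NState.peak_bump, NState.steps_bump, NState.sc_setSc, NState.vi_setSc, NState.vo_setSc, NState.peak_setSc, NState.steps_setSc, Function.update_apply, EmbeddingLike.apply_eq_iff_eq, reduceCtorEq, ite_true, ite_false, Nat.max_zero, lt_self_iff_false, Nat.one_pos, Nat.lt_irrefl, r1, r2, r3, r4, gfr r r1 r2 r3 r4 r5 r6 r7 r8]
        · simp only [eval_seq, eval, gone, g1, hhit, gj, gtmp, gfound, gkout, NState.sc_bump, NState.vi_bump, NState.vo_bump, NState.peak_bump, NState.steps_bump, NState.sc_setSc, NState.vi_setSc, NState.vo_setSc, NState.peak_setSc, NState.steps_setSc, Function.update_apply, EmbeddingLike.apply_eq_iff_eq, reduceCtorEq, ite_true, ite_false, Nat.max_zero, lt_self_iff_false, Nat.one_pos, Nat.lt_irrefl, hr, gor r hr]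
        · simp only [eval_seq, eval, gone, g1, hhit, gj, gtmp, gfound, gkout, NState.sc_bump, NState.vi_bump, NState.vo_bump, NState.peak_bump, NState.steps_bump, NState.sc_setSc, NState.vi_setSc, NState.vo_setSc, NState.peak_setSc, NState.steps_setSc, Function.update_apply, EmbeddingLike.apply_eq_iff_eq, reduceCtorEq, ite_true, ite_false, Nat.max_zero, lt_self_iff_false, Nat.one_pos, Nat.lt_irrefl, gvi]
        · simp only [eval_seq, eval, gone, g1, hhit, gj, gtmp, gfound, gkout, NState.sc_bump, NState.vi_bump, NState.vo_bump, NState.peak_bump, NState.steps_bump, NState.sc_setSc, NState.vi_setSc, NState.vo_setSc, NState.peak_setSc, NState.steps_setSc, Function.update_apply, EmbeddingLike.apply_eq_iff_eq, reduceCtorEq, ite_true, ite_false, Nat.max_zero, lt_self_iff_false, Nat.one_pos, Nat.lt_irrefl, gvo]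
        · simp only [eval_seq, eval, gone, g1, hhit, gj, gtmp, gfound, gkout, NState.sc_bump, NState.vi_bump, NState.vo_bump, NState.peak_bump, NState.steps_bump, NState.sc_setSc, NState.vi_setSc, NState.vo_setSc, NState.peak_setSc, NState.steps_setSc, Function.update_apply, EmbeddingLike.apply_eq_iff_eq, reduceCtorEq, ite_true, ite_false, Nat.max_zero, lt_self_iff_false, Nat.one_pos, Nat.lt_irrefl]; clear * - gpk hcand; omega
        · simp only [eval_seq, eval, gone, g1, hhit, gj, gtmp, gfound, gkout, NState.sc_bump, NState.vi_bump, NState.vo_bump, NState.peak_bump, NState.steps_bump, NState.sc_setSc, NState.vi_setSc, NState.vo_setSc, NState.peak_setSc, NState.steps_setSc, Function.update_apply, EmbeddingLike.apply_eq_iff_eq, reduceCtorEq, ite_true, ite_false, Nat.max_zero, lt_self_iff_false, Nat.one_pos, Nat.lt_irrefl]; rw [Nat.succ_mul]; clear * - gst; omega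
      · rw [Option.not_isSome_iff_eq_none] at hfl
        rw [hfl] at gfound gkout ⊢
        simp only [Option.isSome_none, Option.map_none, Option.getD_none] at gfound gkout
        refine ⟨?_, ?_, ?_, fun r r1 r2 r3 r4 r5 r6 r7 r8 => ?_, fun r hr => ?_, ?_, ?_, ?_, ?_⟩
        · simp only [eval_seq, eval, gone, g1, hhit, gj, gtmp, gfound, gkout, NState.sc_bump, NState.vi_bump, NState.vo_bump, NState.peak_bump, NState.steps_bump, NState.sc_setSc, NState.vi_setSc, NState.vo_setSc, NState.peak_setSc, NState.steps_setSc, Function.update_apply, EmbeddingLike.apply_eq_iff_eq, reduceCtorEq, ite_true, ite_false, Nat.max_zero, lt_self_iff_false, Nat.one_pos, Nat.lt_irrefl]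
        · simp only [eval_seq, eval, gone, g1, hhit, gj, gtmp, gfound, gkout, NState.sc_bump, NState.vi_bump, NState.vo_bump, NState.peak_bump, NState.steps_bump, NState.sc_setSc, NState.vi_setSc, NState.vo_setSc, NState.peak_setSc, NState.steps_setSc, Function.update_apply, EmbeddingLike.apply_eq_iff_eq, reduceCtorEq, ite_true, ite_false, Nat.max_zero, lt_self_iff_false, Nat.one_pos, Nat.lt_irrefl]; simp
        · simp only [eval_seq, eval, gone, g1, hhit, gj, gtmp, gfound, gkout, NState.sc_bump, NState.vi_bump, NState.vo_bump, NState.peak_bump, NState.steps_bump, NState.sc_setSc, NState.vi_setSc, NState.vo_setSc, NState.peak_setSc, NState.steps_setSc, Function.update_apply, EmbeddingLike.apply_eq_iff_eq, reduceCtorEq, ite_true, ite_false, Nat.max_zero, lt_self_iff_false, Nat.one_pos, Nat.lt_irrefl]; simp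
        · simp only [eval_seq, eval, gone, g1, hhit, gj, gtmp, gfound, gkout, NState.sc_bump, NState.vi_bump, NState.vo_bump, NState.peak_bump, NState.steps_bump, NState.sc_setSc, NState.vi_setSc, NState.vo_setSc, NState.peak_setSc, NState.steps_setSc, Function.update_apply, EmbeddingLike.apply_eq_iff_eq, reduceCtorEq, ite_true, ite_false, Nat.max_zero, lt_self_iff_false, Nat.one_pos, Nat.lt_irrefl, r1, r2, r3, r4, gfr r r1 r2 r3 r4 r5 r6 r7 r8]
        · simp only [eval_seq, eval, gone, g1, hhit, gj, gtmp, gfound, gkout, NState.sc_bump, NState.vi_bump, NState.vo_bump, NState.peak_bump, NState.steps_bump, NState.sc_setSc, NState.vi_setSc, NState.vo_setSc, NState.peak_setSc, NState.steps_setSc, Function.update_apply, EmbeddingLike.apply_eq_iff_eq, reduceCtorEq, ite_true, ite_false, Nat.max_zero, lt_self_iff_false, Nat.one_pos, Nat.lt_irrefl, hr, gor r hr]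
        · simp only [eval_seq, eval, gone, g1, hhit, gj, gtmp, gfound, gkout, NState.sc_bump, NState.vi_bump, NState.vo_bump, NState.peak_bump, NState.steps_bump, NState.sc_setSc, NState.vi_setSc, NState.vo_setSc, NState.peak_setSc, NState.steps_setSc, Function.update_apply, EmbeddingLike.apply_eq_iff_eq, reduceCtorEq, ite_true, ite_false, Nat.max_zero, lt_self_iff_false, Nat.one_pos, Nat.lt_irrefl, gvi]
        · simp only [eval_seq, eval, gone, g1, hhit, gj, gtmp, gfound, gkout, NState.sc_bump, NState.vi_bump, NState.vo_bump, NState.peak_bump, NState.steps_bump, NState.sc_setSc, NState.vi_setSc, NState.vo_setSc, NState.peak_setSc, NState.steps_setSc, Function.update_apply, EmbeddingLike.apply_eq_iff_eq, reduceCtorEq, ite_true, ite_false, Nat.max_zero, lt_self_iff_false, Nat.one_pos, Nat.lt_irrefl, gvo]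
        · simp only [eval_seq, eval, gone, g1, hhit, gj, gtmp, gfound, gkout, NState.sc_bump, NState.vi_bump, NState.vo_bump, NState.peak_bump, NState.steps_bump, NState.sc_setSc, NState.vi_setSc, NState.vo_setSc, NState.peak_setSc, NState.steps_setSc, Function.update_apply, EmbeddingLike.apply_eq_iff_eq, reduceCtorEq, ite_true, ite_false, Nat.max_zero, lt_self_iff_false, Nat.one_pos, Nat.lt_irrefl]; clear * - gpk hcand; omega
        · simp only [eval_seq, eval, gone, g1, hhit, gj, gtmp, gfound, gkout, NState.sc_bump, NState.vi_bump, NState.vo_bump, NState.peak_bump, NState.steps_bump, NState.sc_setSc, NState.vi_setSc, NState.vo_setSc, NState.peak_setSc, NState.steps_setSc, Function.update_apply, EmbeddingLike.apply_eq_iff_eq, reduceCtorEq, ite_true, ite_false, Nat.max_zero, lt_self_iff_false, Nat.one_pos, Nat.lt_irrefl]; rw [Nat.succ_mul]; clear * - gst; omega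
    · have keep := hhit
      refine ⟨?_, ?_, ?_, fun r r1 r2 r3 r4 r5 r6 r7 r8 => ?_, fun r hr => ?_, ?_, ?_, ?_, ?_⟩
      · simp only [eval_seq, eval, gone, g1, hhit, gj, gtmp, gfound, gkout, NState.sc_bump, NState.vi_bump, NState.vo_bump, NState.peak_bump, NState.steps_bump, NState.sc_setSc, NState.vi_setSc, NState.vo_setSc, NState.peak_setSc, NState.steps_setSc, Function.update_apply, EmbeddingLike.apply_eq_iff_eq, reduceCtorEq, ite_true, ite_false, Nat.max_zero, lt_self_iff_false, Nat.one_pos, Nat.lt_irrefl]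
      · simp only [eval_seq, eval, gone, g1, hhit, gj, gtmp, gfound, gkout, NState.sc_bump, NState.vi_bump, NState.vo_bump, NState.peak_bump, NState.steps_bump, NState.sc_setSc, NState.vi_setSc, NState.vo_setSc, NState.peak_setSc, NState.steps_setSc, Function.update_apply, EmbeddingLike.apply_eq_iff_eq, reduceCtorEq, ite_true, ite_false, Nat.max_zero, lt_self_iff_false, Nat.one_pos, Nat.lt_irrefl]; simp
      · simp only [eval_seq, eval, gone, g1, hhit, gj, gtmp, gfound, gkout, NState.sc_bump, NState.vi_bump, NState.vo_bump, NState.peak_bump, NState.steps_bump, NState.sc_setSc, NState.vi_setSc, NState.vo_setSc, NState.peak_setSc, NState.steps_setSc, Function.update_apply, EmbeddingLike.apply_eq_iff_eq, reduceCtorEq, ite_true, ite_false, Nat.max_zero, lt_self_iff_false, Nat.one_pos, Nat.lt_irrefl]; simp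
      · simp only [eval_seq, eval, gone, g1, hhit, gj, gtmp, gfound, gkout, NState.sc_bump, NState.vi_bump, NState.vo_bump, NState.peak_bump, NState.steps_bump, NState.sc_setSc, NState.vi_setSc, NState.vo_setSc, NState.peak_setSc, NState.steps_setSc, Function.update_apply, EmbeddingLike.apply_eq_iff_eq, reduceCtorEq, ite_true, ite_false, Nat.max_zero, lt_self_iff_false, Nat.one_pos, Nat.lt_irrefl, r1, r2, r3, r4, gfr r r1 r2 r3 r4 r5 r6 r7 r8]
      · simp only [eval_seq, eval, gone, g1, hhit, gj, gtmp, gfound, gkout, NState.sc_bump, NState.vi_bump, NState.vo_bump, NState.peak_bump, NState.steps_bump, NState.sc_setSc, NState.vi_setSc, NState.vo_setSc, NState.peak_setSc, NState.steps_setSc, Function.update_apply, EmbeddingLike.apply_eq_iff_eq, reduceCtorEq, ite_true, ite_false, Nat.max_zero, lt_self_iff_false, Nat.one_pos, Nat.lt_irrefl, hr, gor r hr]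
      · simp only [eval_seq, eval, gone, g1, hhit, gj, gtmp, gfound, gkout, NState.sc_bump, NState.vi_bump, NState.vo_bump, NState.peak_bump, NState.steps_bump, NState.sc_setSc, NState.vi_setSc, NState.vo_setSc, NState.peak_setSc, NState.steps_setSc, Function.update_apply, EmbeddingLike.apply_eq_iff_eq, reduceCtorEq, ite_true, ite_false, Nat.max_zero, lt_self_iff_false, Nat.one_pos, Nat.lt_irrefl, gvi]
      · simp only [eval_seq, eval, gone, g1, hhit, gj, gtmp, gfound, gkout, NState.sc_bump, NState.vi_bump, NState.vo_bump, NState.peak_bump, NState.steps_bump, NState.sc_setSc, NState.vi_setSc, NState.vo_setSc, NState.peak_setSc, NState.steps_setSc, Function.update_apply, EmbeddingLike.apply_eq_iff_eq, reduceCtorEq, ite_true, ite_false, Nat.max_zero, lt_self_iff_false, Nat.one_pos, Nat.lt_irrefl, gvo]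
      · simp only [eval_seq, eval, gone, g1, hhit, gj, gtmp, gfound, gkout, NState.sc_bump, NState.vi_bump, NState.vo_bump, NState.peak_bump, NState.steps_bump, NState.sc_setSc, NState.vi_setSc, NState.vo_setSc, NState.peak_setSc, NState.steps_setSc, Function.update_apply, EmbeddingLike.apply_eq_iff_eq, reduceCtorEq, ite_true, ite_false, Nat.max_zero, lt_self_iff_false, Nat.one_pos, Nat.lt_irrefl]; clear * - gpk hcand; omega
      · simp only [eval_seq, eval, gone, g1, hhit, gj, gtmp, gfound, gkout, NState.sc_bump, NState.vi_bump, NState.vo_bump, NState.peak_bump, NState.steps_bump, NState.sc_setSc, NState.vi_setSc, NState.vo_setSc, NState.peak_setSc, NState.steps_setSc, Function.update_apply, EmbeddingLike.apply_eq_iff_eq, reduceCtorEq, ite_true, ite_false, Nat.max_zero, lt_self_iff_false, Nat.one_pos, Nat.lt_irrefl]; rw [Nat.succ_mul]; clear * - gst; omega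

end Ap

/-! ### From the first block and the first candidate to the least candidate -/

section Least

variable {N s M d : ℕ}

/-- `find?` over `range n` returns the least index satisfying the predicate. [folklore] -/
theorem find?_range_eq_some {p : ℕ → Bool} {n i : ℕ} :
    (List.range n).find? p = some i ↔ i < n ∧ p i = true ∧ ∀ j, j < i → p j = false := by
  rw [List.find?_eq_some_iff_getElem]
  constructor
  · rintro ⟨hp, k, hk, hki, hlt⟩
    rw [List.getElem_range] at hki
    subst hki
    refine ⟨by simpa using hk, hp, fun j hj => ?_⟩
    have := hlt j hj
    simpa [List.getElem_range] using this
  · rintro ⟨hi, hp, hlt⟩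
    refine ⟨hp, i, by simpa using hi, by simp, fun j hj => ?_⟩
    simpa [List.getElem_range] using hlt j hj

/-- `find?` over `range n` fails iff no index satisfies the predicate. [folklore] -/
theorem find?_range_eq_none {p : ℕ → Bool} {n : ℕ} : (List.range n).find? p = none ↔ ∀ j, j < n → p j = false := by
  rw [List.find?_eq_none]; simp

/-- **The scan finds the least candidate.**  With the block values `ws_u ≡ ∏_j (s + M (u d + j))`
(`u < d = |ws|`): if the block scan finds block `u₀` then the candidate scan of that block finds
some `j₀`, and `k₀ = u₀ d + j₀ + 1` is the least `k` in `1 … d²` with `gcd (s + M k, N) > 1`;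
if it finds no block, there is no such `k`. [Harvey 2021, proof of Prop. 2.5] [folklore] -/
theorem apScan_least (hN : 1 ≤ N) (hd : 1 ≤ d) {ws : List ℕ} (hws : ws.length = d)
    (hval : ∀ u, u < d → ws.getD u 0 = apBlockProd s M d u % N) :
    (blockFirst N ws d = none → ∀ k, 1 ≤ k → k ≤ d * d → Nat.gcd (apCand s M k) N ≤ 1) ∧
    (∀ u0, blockFirst N ws d = some u0 → ∃ j0, candFirst N s M u0 d d = some j0 ∧
      1 ≤ u0 * d + (j0 + 1) ∧ u0 * d + (j0 + 1) ≤ d * d ∧ 1 < Nat.gcd (apCand s M (u0 * d + (j0 + 1))) N ∧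
      ∀ k, 1 ≤ k → k < u0 * d + (j0 + 1) → Nat.gcd (apCand s M k) N ≤ 1) := by
  -- block `u` is hit iff one of its candidates is
  have hblk : ∀ u, u < d → (1 < Nat.gcd (ws.getD u 0) N ↔ ∃ j, j < d ∧ 1 < Nat.gcd (apCand s M (u * d + (j + 1))) N) := by
    intro u hu; rw [hval u hu]; exact apBlock_criterion hN u
  -- every `k` in `1 … d²` is a candidate of block `(k-1)/d`
  have hdec : ∀ k, 1 ≤ k → k ≤ d * d → ∃ u j, u < d ∧ j < d ∧ k = u * d + (j + 1) := by
    intro k hk1 hk2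
    refine ⟨(k - 1) / d, (k - 1) % d, ?_, Nat.mod_lt _ (by omega), ?_⟩
    · exact Nat.div_lt_of_lt_mul (by rw [Nat.mul_comm]; omega)
    · have := Nat.div_add_mod (k - 1) d; rw [Nat.mul_comm] at this; omega
  constructor
  · intro hnone k hk1 hk2
    obtain ⟨u, j, hu, hj, rfl⟩ := hdec k hk1 hk2
    rw [blockFirst, find?_range_eq_none] at hnone
    have := hnone u hu
    simp only [decide_eq_false_iff_not] at this
    rw [hblk u hu, not_exists] at this
    exact Nat.le_of_not_lt fun h => this j ⟨hj, h⟩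
  · intro u0 hu0
    rw [blockFirst, find?_range_eq_some] at hu0
    obtain ⟨hu0d, hhit, hbefore⟩ := hu0
    simp only [decide_eq_true_eq] at hhit
    obtain ⟨j, hj, hjhit⟩ := (hblk u0 hu0d).1 hhit
    -- the candidate scan of block `u0` finds the least `j0`
    have hsome : (candFirst N s M u0 d d).isSome := by
      rw [Option.isSome_iff_ne_none]; intro hnone
      rw [candFirst, find?_range_eq_none] at hnone
      have := hnone j hj; simp only [decide_eq_false_iff_not] at this; exact this hjhit
    obtain ⟨j0, hj0⟩ := Option.isSome_iff_exists.1 hsome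
    refine ⟨j0, hj0, ?_⟩
    rw [candFirst, find?_range_eq_some] at hj0
    obtain ⟨hj0d, hj0hit, hj0before⟩ := hj0
    simp only [decide_eq_true_eq] at hj0hit
    refine ⟨by omega, by nlinarith, hj0hit, fun k hk1 hk2 => ?_⟩
    obtain ⟨u, j', hu, hj', rfl⟩ := hdec k hk1 (by nlinarith)
    -- `u ≤ u0`; earlier blocks have no hit, in block `u0` earlier candidates have no hit
    rcases Nat.lt_or_ge u u0 with hlt | hge
    · have := hbefore u hlt
      simp only [decide_eq_false_iff_not] at this
      rw [hblk u hu, not_exists] at this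
      exact Nat.le_of_not_lt fun h => this j' ⟨hj', h⟩
    · have hu' : u = u0 := by
        by_contra hne
        have : u0 + 1 ≤ u := by omega
        nlinarith
      subst hu'
      have hjj : j' < j0 := by omega
      have := hj0before j' hjj
      simp only [decide_eq_false_iff_not, not_lt] at this
      exact this

end Least

/-- The exact length of the stored tree. [folklore] -/
theorem length_treeAcc {N : ℕ} (vals : List ℕ) (K : ℕ) : ∀ {d : ℕ}, d ≤ K + 1 → (treeAcc N vals K d).length + 2 ^ (K + 1 - d) = d * 2 ^ K + 2 ^ (K + 1)
  | 0, _ => by simp [treeAcc]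
  | d + 1, hd => by
    have ih := length_treeAcc (N := N) vals K (d := d) (by omega)
    rw [treeAcc, List.length_append, length_blocksFrom, Nat.succ_mul]
    have e1 : 2 ^ (K - d) * (2 ^ d + 1) = 2 ^ K + 2 ^ (K - d) := by
      rw [Nat.mul_add, Nat.mul_one, ← pow_add, Nat.sub_add_cancel (by omega)]
    have e2 : 2 ^ (K + 1 - d) = 2 ^ (K - d) + 2 ^ (K + 1 - (d + 1)) := by
      rw [show K + 1 - d = (K - d) + 1 by omega, pow_succ, show K + 1 - (d + 1) = K - d by omega]; ring
    omega

/-- The length of the whole stored tree: `(K + 3) 2^K - 1`. [folklore] -/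
theorem length_treeAcc_full {N : ℕ} (vals : List ℕ) (K : ℕ) : (treeAcc N vals K (K + 1)).length = (K + 3) * 2 ^ K - 1 := by
  have := length_treeAcc (N := N) vals K (d := K + 1) le_rfl
  rw [Nat.sub_self, pow_zero, pow_succ] at this
  have h3 : (K + 3) * 2 ^ K = (K + 1) * 2 ^ K + 2 ^ K * 2 := by ring
  omega

end NCom

end Literature.Computability.Complexity
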